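import Literature.AlgebraicGeometry.HodgeTheory.HodgeClassOfMorphismProofs
import Literature.AlgebraicGeometry.HodgeTheory.ComplexGysinCorrespondence
import Literature.AlgebraicGeometry.HodgeTheory.ComplexOrientationCycleClassFacts
import Literature.AlgebraicGeometry.HodgeTheory.HodgeTypeExteriorProduct
import Literature.AlgebraicGeometry.HodgeTheory.HodgeTypeConjugation
import Literature.AlgebraicGeometry.HodgeTheory.AlgebraicClassesHodgeTypeHolds
import Literature.AlgebraicGeometry.HodgeTheory.HardLefschetzThreefold
import Literature.NumberTheory.Transcendental.DeRhamTheoremMultiplicative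

/-!
# Crux `TranscendentalOrSupported` (stmt-HodgeConjecture-10853), line `HodgeEffectivity`:
# Hodge effectivity in correspondence form from its abstract (Hodge-structure) form, and back

Route `LinearSystemTorelli`, crux `TranscendentalOrSupported` = GHC(2p, coniveau 1). The line
`HodgeEffectivity` (`Cruxes/TranscendentalOrSupported/Lines/HodgeEffectivity.lean`) reduces the crux
to `MiddleDivisorSupport` (item 1081, the Hodge conjecture for the middle cohomology) and ONE
Hodge-theoretic statement, Voisin's Conjecture 4.7 (J. Open Math. Probl. 1 (2025) §4.2) for the
coniveau-1 phantom constituents `W` of `H²ᵖ(X^{2p})`. Skeleton v1/v2 carried it in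
Hodge-CORRESPONDENCE form (`stub_hodgeEffective`: `W` lies in the sum of the images of the actions
`κ_* = pr_{X*}(pr_Y^* – ∪ κ)` of rational Hodge classes `κ` of type `(e,e)` on products `X ⊗ Y`,
`e ≥ dim Y + 1`). Skeleton v3 (lead c5) carries it in its ABSTRACT form
(`stub_hodgeEffectiveAbstract`): `W` lies in the sum of the images of the RATIONAL HODGE-STRUCTURE
MORPHISMS `φ : Hᵃ(Y(ℂ); ℂ) → H²ᵖ(X(ℂ); ℂ)` of bidegree `(r, r)`, `r ≥ 1`, from the cohomology of
smooth projective varieties `Y` — "the Tate twist of `W` is effective", Voisin's Conj. 4.7 in its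
own terms (up to `Y ↦ Y × ℙ^{r-1}` and semisimplicity). This file lands the registered bridge stub

* `stub_hodgeEffective_of_abstract` : abstract form (∀ X) → correspondence form (∀ X),

a forty-line consequence of Voisin I, Lemma 11.41 ON THE TREE'S CARRIERS, which is a THEOREM of the
tree: `exists_rational_hodgeClass_corrAction_eq_smul` (`HodgeClassOfMorphismProofs`, from Künneth,
the perfect cup pairing with its rational and Hodge-orthogonality structure, Hodge types of exterior
products and de Rham's theorem in multiplicative form — all proved): a rational type-`(r, r)` map
`φ : Hᵃ(Y(ℂ)) → H²ᵖ(X(ℂ))` is `t⁻¹ • κ_*` for a rational class `κ ∈ H^{2(m+r)}((X ⊗ Y)(ℂ); ℂ)` of Hodge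
type `(m + r, m + r)`, `t ≠ 0`; with `r ≥ 1` this is a summand of the correspondence form
(`e = m + r ≥ m + 1`, `a + 2e = 2p + 2m`).

It also proves the converse `hodgeEffectiveAbstractAt_of_hodgeEffectiveAt` (per `X`, hence ∀ X):
the action of a rational Hodge class `κ` of type `(e,e)`, `e = m + r`, IS a rational
Hodge-structure morphism of bidegree `(r, r)` for the complex orientation family (pull-back
preserves types and rationality, cup product adds types and preserves rationality, the Gysin
morphism of `pr_X` shifts types by `(-m, -m)` and preserves rationality) and every orientation
family gives the same image. So the reshaping v2 → v3 of the line is LOSSLESS: the two forms of the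
bet are equivalent by theorems of the tree, and the crux is `MiddleDivisorSupport ∧ HodgeEffectiveAbstract`
(with the landed assembly `stub_transcendentalOrSupported_of_middle_of_hodgeEffective`).

References: C. Voisin, Hodge Theory and Complex Algebraic Geometry I (2002), §7.3.1 Def. 7.22,
§11.3.3 Thm. 11.38 and Lemma 11.41; C. Voisin, J. Open Math. Probl. 1 (2025), Lemma 2.9, Conj. 4.7,
Prop. 4.8.
-/

noncomputable section

set_option linter.dupNamespace false

open CategoryTheory MonoidalCategory CartesianMonoidalCategory
open Literature.AlgebraicGeometry.Motives Literature.AlgebraicGeometry.HodgeTheory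
open Literature.AlgebraicTopology.SingularHomology

namespace Summit.HodgeConjecture.HodgeConjecture.Theorems

/-! ### Abstract ⟹ correspondence form (Voisin I, Lemma 11.41, a theorem of the tree) -/

/-- **Per-`X` bridge**: if a subspace `W ⊆ H²ᵖ(X(ℂ); ℂ)` lies in the sum of the images of the
rational Hodge-structure morphisms `φ : Hᵃ(Y(ℂ)) → H²ᵖ(X(ℂ))` of bidegree `(r, r)`, `r ≥ 1` (types
read in the model `A` of `X` and any model `B` of `Y`), from smooth projective `Y`, then `W` lies in
the sum of the images of the correspondence actions `κ_*` of rational Hodge classes `κ` of type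
`(e, e)` on `X ⊗ Y` with `e ≥ dim Y + 1`: each `φ` is `t⁻¹ • κ_*` for such a `κ` with `e = dim Y + r`
(`exists_rational_hodgeClass_corrAction_eq_smul`, Voisin I Lemma 11.41 on the carriers).
[cite: VoisinHodgeI2002, §11.3.3 Lemma 11.41] [cite: Voisin2025, Lemma 2.9] -/
theorem le_hodgeCorrespondences_of_le_hodgeMaps {p : ℕ} {X : SchemeOver ℂ}
    (hX : IsSmoothProjective (2 * p) X) (A : HodgeModel (2 * p) X)
    {W : Submodule ℂ (complexBetti X (2 * p))}
    (hW : W ≤ ⨆ (m : ℕ) (Y : SchemeOver ℂ) (_ : IsSmoothProjective m Y) (B : HodgeModel m Y)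
      (a : ℕ) (r : ℕ) (_ : a + 2 * r = 2 * p) (_ : 1 ≤ r)
      (φ : complexBetti Y a →ₗ[ℂ] complexBetti X (2 * p))
      (_ : ∀ c, IsRationalClass c → IsRationalClass (φ c))
      (_ : ∀ (p' q' : ℕ), p' + q' = a → ∀ c, B.pullback a c ∈ B.hodgePQ a p' q' →
        A.pullback (2 * p) (φ c) ∈ A.hodgePQ (2 * p) (p' + r) (q' + r)),
      LinearMap.range φ) :
    W ≤ ⨆ (μ : OrientationFamily) (m : ℕ) (Y : SchemeOver ℂ) (hY : IsSmoothProjective m Y)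
        (a : ℕ) (e : ℕ) (hab : a + 2 * e = 2 * p + 2 * m) (_ : m + 1 ≤ e)
        (κ : complexBetti (X ⊗ Y) (2 * e)) (_ : IsRationalClass κ)
        (_ : IsOfHodgeType (2 * p + m) (X ⊗ Y) (2 * e) e e κ),
        LinearMap.range (corrAction μ hX hY hab κ) := by
  refine hW.trans ?_
  refine iSup_le fun m ↦ iSup_le fun Y ↦ iSup_le fun hY ↦ iSup_le fun B ↦ iSup_le fun a ↦
    iSup_le fun r ↦ iSup_le fun har ↦ iSup_le fun hr ↦ iSup_le fun φ ↦ iSup_le fun hφ ↦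
    iSup_le fun hφH ↦ ?_
  set ν : OrientationFamily := complexOrientationFamily with hν
  have hab : a + 2 * (m + r) = 2 * p + 2 * m := by omega
  obtain ⟨γ, hγ, hγH, t, ht, heq⟩ :=
    exists_rational_hodgeClass_corrAction_eq_smul hX hY A B hab rfl φ hφ hφH ν
  refine le_iSup_of_le ν (le_iSup_of_le m (le_iSup_of_le Y (le_iSup_of_le hY (le_iSup_of_le a
    (le_iSup_of_le (m + r) (le_iSup_of_le hab (le_iSup_of_le (by omega) (le_iSup_of_le γ
    (le_iSup_of_le hγ (le_iSup_of_le hγH ?_))))))))))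
  rw [heq, LinearMap.range_smul _ _ ht]

/-- **Stub `stub_hodgeEffective_of_abstract` of line `HodgeEffectivity`** (crux
`TranscendentalOrSupported`, stmt-HodgeConjecture-10853; registered bridge, skeleton v3): Hodge
effectivity of the coniveau-1 phantom constituents of `H²ᵖ(X^{2p})` in its ABSTRACT form — every
irreducible rationally spanned sub-Hodge structure `W ⊆ H²ᵖ(X(ℂ); ℂ)` of rank `≥ 2` without
`(2p,0)`-part lies in the sum of the images of the rational Hodge-structure morphisms of bidegree
`(r, r)`, `r ≥ 1`, from the cohomology of smooth projective varieties (Voisin's Conj. 4.7 for these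
`W`) — implies the CORRESPONDENCE form `stub_hodgeEffective` of skeleton v1/v2 (the sum of the images
of the actions of rational Hodge classes of type `(e,e)`, `e ≥ dim Y + 1`, on products `X ⊗ Y`), by
Voisin I Lemma 11.41 on the tree's carriers (`le_hodgeCorrespondences_of_le_hodgeMaps`).
[cite: VoisinHodgeI2002, §11.3.3 Lemma 11.41] [cite: Voisin2025, Lemma 2.9 and Conj. 4.7] -/
theorem stub_hodgeEffective_of_abstract
    (hAbs : ∀ ⦃p : ℕ⦄ ⦃X : SchemeOver ℂ⦄, 1 ≤ p → ∀ (hX : IsSmoothProjective (2 * p) X)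
      (A : HodgeModel (2 * p) X) (r : ℕ) (b : Fin r → complexBetti X (2 * p)),
      (∀ j, IsRationalClass (b j)) →
      (Submodule.span ℂ (Set.range b)).map (A.pullback (2 * p)).hom =
        ⨆ (p' : ℕ) (q' : ℕ) (_ : p' + q' = 2 * p),
          (Submodule.span ℂ (Set.range b)).map (A.pullback (2 * p)).hom ⊓ A.hodgePQ (2 * p) p' q' →
      (Submodule.span ℂ (Set.range b)).map (A.pullback (2 * p)).hom ⊓ A.hodgePQ (2 * p) (2 * p) 0 = ⊥ →
      (∀ V : Submodule ℂ (complexBetti X (2 * p)), V ≤ Submodule.span ℂ (Set.range b) →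
        Submodule.span ℂ {x : complexBetti X (2 * p) | x ∈ V ∧ IsRationalClass x} = V →
        V.map (A.pullback (2 * p)).hom =
          ⨆ (p' : ℕ) (q' : ℕ) (_ : p' + q' = 2 * p),
            V.map (A.pullback (2 * p)).hom ⊓ A.hodgePQ (2 * p) p' q' →
        V = ⊥ ∨ V = Submodule.span ℂ (Set.range b)) →
      2 ≤ Module.finrank ℂ (Submodule.span ℂ (Set.range b)) →
      Submodule.span ℂ (Set.range b) ≤
        ⨆ (m : ℕ) (Y : SchemeOver ℂ) (_ : IsSmoothProjective m Y) (B : HodgeModel m Y)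
          (a : ℕ) (r : ℕ) (_ : a + 2 * r = 2 * p) (_ : 1 ≤ r)
          (φ : complexBetti Y a →ₗ[ℂ] complexBetti X (2 * p))
          (_ : ∀ c, IsRationalClass c → IsRationalClass (φ c))
          (_ : ∀ (p' q' : ℕ), p' + q' = a → ∀ c, B.pullback a c ∈ B.hodgePQ a p' q' →
            A.pullback (2 * p) (φ c) ∈ A.hodgePQ (2 * p) (p' + r) (q' + r)),
          LinearMap.range φ) :
    ∀ ⦃p : ℕ⦄ ⦃X : SchemeOver ℂ⦄, 1 ≤ p → ∀ (hX : IsSmoothProjective (2 * p) X)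
      (A : HodgeModel (2 * p) X) (r : ℕ) (b : Fin r → complexBetti X (2 * p)),
      (∀ j, IsRationalClass (b j)) →
      (Submodule.span ℂ (Set.range b)).map (A.pullback (2 * p)).hom =
        ⨆ (p' : ℕ) (q' : ℕ) (_ : p' + q' = 2 * p),
          (Submodule.span ℂ (Set.range b)).map (A.pullback (2 * p)).hom ⊓ A.hodgePQ (2 * p) p' q' →
      (Submodule.span ℂ (Set.range b)).map (A.pullback (2 * p)).hom ⊓ A.hodgePQ (2 * p) (2 * p) 0 = ⊥ →
      (∀ V : Submodule ℂ (complexBetti X (2 * p)), V ≤ Submodule.span ℂ (Set.range b) →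
        Submodule.span ℂ {x : complexBetti X (2 * p) | x ∈ V ∧ IsRationalClass x} = V →
        V.map (A.pullback (2 * p)).hom =
          ⨆ (p' : ℕ) (q' : ℕ) (_ : p' + q' = 2 * p),
            V.map (A.pullback (2 * p)).hom ⊓ A.hodgePQ (2 * p) p' q' →
        V = ⊥ ∨ V = Submodule.span ℂ (Set.range b)) →
      2 ≤ Module.finrank ℂ (Submodule.span ℂ (Set.range b)) →
      Submodule.span ℂ (Set.range b) ≤
        ⨆ (μ : OrientationFamily) (m : ℕ) (Y : SchemeOver ℂ) (hY : IsSmoothProjective m Y)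
          (a : ℕ) (e : ℕ) (hab : a + 2 * e = 2 * p + 2 * m) (_ : m + 1 ≤ e)
          (κ : complexBetti (X ⊗ Y) (2 * e)) (_ : IsRationalClass κ)
          (_ : IsOfHodgeType (2 * p + m) (X ⊗ Y) (2 * e) e e κ),
          LinearMap.range (corrAction μ hX hY hab κ) :=
  fun _ _ hp hX A r b hb hsub hbot hirr hge ↦
    le_hodgeCorrespondences_of_le_hodgeMaps hX A (hAbs hp hX A r b hb hsub hbot hirr hge)

/-! ### Correspondence ⟹ abstract form (the action of a rational Hodge class is a rational Hodge map) -/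

/-- **The action `κ_* = pr_{X*}(pr_Y^* – ∪ κ)` of a RATIONAL class `κ` of Hodge type `(e, e)` on
`X ⊗ Y` (`e = dim Y + r`), for the complex orientation family, is a rational Hodge-structure
morphism `Hᵃ(Y(ℂ)) → Hᵇ(X(ℂ))` of bidegree `(r, r)`**: pull-back along `pr_Y` preserves rationality
and Hodge types, cup product with `κ` preserves rationality and adds `(e, e)` to the type (de Rham's
theorem in multiplicative form, a theorem of the tree), and the Gysin morphism of `pr_X` (relative
dimension `dim Y`) preserves rationality for the complex orientations and shifts types by
`(-dim Y, -dim Y)`. [cite: VoisinHodgeI2002, §7.3.2 and §11.3.3 Lemma 11.41]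
[cite: VoisinHodgeII2003, proof of Thm. 10.17 (10.7)] -/
theorem corrAction_isRationalHodgeMap {n m : ℕ} {X Y : SchemeOver ℂ}
    (hX : IsSmoothProjective n X) (hY : IsSmoothProjective m Y) (A : HodgeModel n X)
    (B : HodgeModel m Y) {a b e r : ℕ} (hab : a + 2 * e = b + 2 * m) (her : m + r = e)
    {κ : complexBetti (X ⊗ Y) (2 * e)} (hκ : IsRationalClass κ)
    (hκH : IsOfHodgeType (n + m) (X ⊗ Y) (2 * e) e e κ) :
    (∀ c, IsRationalClass c →
        IsRationalClass (corrAction complexOrientationFamily hX hY hab κ c)) ∧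
      ∀ (p' q' : ℕ), p' + q' = a → ∀ c, B.pullback a c ∈ B.hodgePQ a p' q' →
        A.pullback b (corrAction complexOrientationFamily hX hY hab κ c) ∈
          A.hodgePQ b (p' + r) (q' + r) := by
  have hXY := IsSmoothProjective.tensor_holds hX hY
  refine ⟨fun c hc ↦ ?_, fun p' q' _ c hc ↦ ?_⟩
  · rw [corrAction_apply]
    exact isRationalClass_complexGysin_complexOrientationFamily hXY hX (fst X Y) _
      (IsRationalClass.cup rfl (hc.map _) hκ)
  · have hcT : IsOfHodgeType m Y a p' q' c := (isOfHodgeType_iff_mem_hodgePQ hY B c).2 hc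
    have hcup : IsOfHodgeType (n + m) (X ⊗ Y) (a + 2 * e) (p' + e) (q' + e)
        (cupProduct (rfl : a + 2 * e = a + 2 * e) (complexBetti.map (snd X Y) a c) κ) :=
      cupPreservesHodgeType_of_multiplicative_deRham
        (fun E _ _ _ ↦ Literature.NumberTheory.Transcendental.exists_deRhamIsoFamily_holds E) hXY
        rfl (hcT.map_of_isSmoothProjective hXY hY (snd X Y)) hκH
    have hg : IsOfHodgeType n X b (p' + r) (q' + r)
        (corrAction complexOrientationFamily hX hY hab κ c) := by
      rw [corrAction_apply]
      exact isOfHodgeType_complexGysin hodgePQ_independent_of_hodgeModel_holds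
        (fun _ _ ↦ nonempty_hodgeModel_holds)
        (fun E _ _ _ ↦ Literature.NumberTheory.Transcendental.exists_deRhamIsoFamily_holds E)
        complexOrientationFamily hXY hX (fst X Y) _ (by omega) (by omega) hcup
    exact (isOfHodgeType_iff_mem_hodgePQ hX A _).1 hg

/-- **Per-`X` converse bridge**: if `W ⊆ H²ᵖ(X(ℂ); ℂ)` lies in the sum of the images of the
correspondence actions of rational Hodge classes `κ` of type `(e,e)` on products `X ⊗ Y`,
`e ≥ dim Y + 1`, then it lies in the sum of the images of the rational Hodge-structure morphisms of
bidegree `(r, r)`, `r ≥ 1`, from the cohomology of smooth projective varieties: every orientation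
family gives the same image as the complex one (`corrAction_eq_smul_of_orientationFamily`), whose
action is such a morphism with `r = e - dim Y` (`corrAction_isRationalHodgeMap`).
[cite: VoisinHodgeI2002, §11.3.3 Lemma 11.41] [cite: Voisin2025, Lemma 2.9] -/
theorem le_hodgeMaps_of_le_hodgeCorrespondences {p : ℕ} {X : SchemeOver ℂ}
    (hX : IsSmoothProjective (2 * p) X) (A : HodgeModel (2 * p) X)
    {W : Submodule ℂ (complexBetti X (2 * p))}
    (hW : W ≤ ⨆ (μ : OrientationFamily) (m : ℕ) (Y : SchemeOver ℂ) (hY : IsSmoothProjective m Y)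
        (a : ℕ) (e : ℕ) (hab : a + 2 * e = 2 * p + 2 * m) (_ : m + 1 ≤ e)
        (κ : complexBetti (X ⊗ Y) (2 * e)) (_ : IsRationalClass κ)
        (_ : IsOfHodgeType (2 * p + m) (X ⊗ Y) (2 * e) e e κ),
        LinearMap.range (corrAction μ hX hY hab κ)) :
    W ≤ ⨆ (m : ℕ) (Y : SchemeOver ℂ) (_ : IsSmoothProjective m Y) (B : HodgeModel m Y)
      (a : ℕ) (r : ℕ) (_ : a + 2 * r = 2 * p) (_ : 1 ≤ r)
      (φ : complexBetti Y a →ₗ[ℂ] complexBetti X (2 * p))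
      (_ : ∀ c, IsRationalClass c → IsRationalClass (φ c))
      (_ : ∀ (p' q' : ℕ), p' + q' = a → ∀ c, B.pullback a c ∈ B.hodgePQ a p' q' →
        A.pullback (2 * p) (φ c) ∈ A.hodgePQ (2 * p) (p' + r) (q' + r)),
      LinearMap.range φ := by
  refine hW.trans ?_
  refine iSup_le fun μ ↦ iSup_le fun m ↦ iSup_le fun Y ↦ iSup_le fun hY ↦ iSup_le fun a ↦
    iSup_le fun e ↦ iSup_le fun hab ↦ iSup_le fun he ↦ iSup_le fun κ ↦ iSup_le fun hκ ↦
    iSup_le fun hκH ↦ ?_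
  set ν : OrientationFamily := complexOrientationFamily with hν
  obtain ⟨B⟩ := nonempty_hodgeModel_holds (n := m) (X := Y) hY
  -- every orientation family gives the same image as the complex one
  obtain ⟨t, ht, heq⟩ := corrAction_eq_smul_of_orientationFamily ν.hasPoincareDuality
    μ.hasPoincareDuality hX hY hab (e := e)
  have hrange : LinearMap.range (corrAction μ hX hY hab κ) =
      LinearMap.range (corrAction ν hX hY hab κ) := by
    rw [heq, LinearMap.smul_apply, LinearMap.range_smul _ _ ht]
  rw [hrange]
  obtain ⟨hφ, hφH⟩ := corrAction_isRationalHodgeMap hX hY A B hab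
    (show m + (e - m) = e by omega) hκ hκH
  exact le_iSup_of_le m (le_iSup_of_le Y (le_iSup_of_le hY (le_iSup_of_le B (le_iSup_of_le a
    (le_iSup_of_le (e - m) (le_iSup_of_le (by omega) (le_iSup_of_le (by omega)
    (le_iSup_of_le (corrAction ν hX hY hab κ) (le_iSup_of_le hφ (le_iSup_of_le hφH le_rfl))))))))))

/-- **TIGHTNESS of the reshaping (correspondence form ⟹ abstract form, ∀ X)**: the
correspondence form `stub_hodgeEffective` of skeleton v1/v2 implies the abstract form
`stub_hodgeEffectiveAbstract` of skeleton v3; with `stub_hodgeEffective_of_abstract` the two forms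
of the line's bet are EQUIVALENT by theorems of the tree.
[cite: VoisinHodgeI2002, §11.3.3 Lemma 11.41] [cite: Voisin2025, Lemma 2.9 and Conj. 4.7] -/
theorem hodgeEffectiveAbstract_of_hodgeEffective
    (hEff : ∀ ⦃p : ℕ⦄ ⦃X : SchemeOver ℂ⦄, 1 ≤ p → ∀ (hX : IsSmoothProjective (2 * p) X)
      (A : HodgeModel (2 * p) X) (r : ℕ) (b : Fin r → complexBetti X (2 * p)),
      (∀ j, IsRationalClass (b j)) →
      (Submodule.span ℂ (Set.range b)).map (A.pullback (2 * p)).hom =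
        ⨆ (p' : ℕ) (q' : ℕ) (_ : p' + q' = 2 * p),
          (Submodule.span ℂ (Set.range b)).map (A.pullback (2 * p)).hom ⊓ A.hodgePQ (2 * p) p' q' →
      (Submodule.span ℂ (Set.range b)).map (A.pullback (2 * p)).hom ⊓ A.hodgePQ (2 * p) (2 * p) 0 = ⊥ →
      (∀ V : Submodule ℂ (complexBetti X (2 * p)), V ≤ Submodule.span ℂ (Set.range b) →
        Submodule.span ℂ {x : complexBetti X (2 * p) | x ∈ V ∧ IsRationalClass x} = V →
        V.map (A.pullback (2 * p)).hom =
          ⨆ (p' : ℕ) (q' : ℕ) (_ : p' + q' = 2 * p),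
            V.map (A.pullback (2 * p)).hom ⊓ A.hodgePQ (2 * p) p' q' →
        V = ⊥ ∨ V = Submodule.span ℂ (Set.range b)) →
      2 ≤ Module.finrank ℂ (Submodule.span ℂ (Set.range b)) →
      Submodule.span ℂ (Set.range b) ≤
        ⨆ (μ : OrientationFamily) (m : ℕ) (Y : SchemeOver ℂ) (hY : IsSmoothProjective m Y)
          (a : ℕ) (e : ℕ) (hab : a + 2 * e = 2 * p + 2 * m) (_ : m + 1 ≤ e)
          (κ : complexBetti (X ⊗ Y) (2 * e)) (_ : IsRationalClass κ)
          (_ : IsOfHodgeType (2 * p + m) (X ⊗ Y) (2 * e) e e κ),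
          LinearMap.range (corrAction μ hX hY hab κ)) :
    ∀ ⦃p : ℕ⦄ ⦃X : SchemeOver ℂ⦄, 1 ≤ p → ∀ (hX : IsSmoothProjective (2 * p) X)
      (A : HodgeModel (2 * p) X) (r : ℕ) (b : Fin r → complexBetti X (2 * p)),
      (∀ j, IsRationalClass (b j)) →
      (Submodule.span ℂ (Set.range b)).map (A.pullback (2 * p)).hom =
        ⨆ (p' : ℕ) (q' : ℕ) (_ : p' + q' = 2 * p),
          (Submodule.span ℂ (Set.range b)).map (A.pullback (2 * p)).hom ⊓ A.hodgePQ (2 * p) p' q' →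
      (Submodule.span ℂ (Set.range b)).map (A.pullback (2 * p)).hom ⊓ A.hodgePQ (2 * p) (2 * p) 0 = ⊥ →
      (∀ V : Submodule ℂ (complexBetti X (2 * p)), V ≤ Submodule.span ℂ (Set.range b) →
        Submodule.span ℂ {x : complexBetti X (2 * p) | x ∈ V ∧ IsRationalClass x} = V →
        V.map (A.pullback (2 * p)).hom =
          ⨆ (p' : ℕ) (q' : ℕ) (_ : p' + q' = 2 * p),
            V.map (A.pullback (2 * p)).hom ⊓ A.hodgePQ (2 * p) p' q' →
        V = ⊥ ∨ V = Submodule.span ℂ (Set.range b)) →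
      2 ≤ Module.finrank ℂ (Submodule.span ℂ (Set.range b)) →
      Submodule.span ℂ (Set.range b) ≤
        ⨆ (m : ℕ) (Y : SchemeOver ℂ) (_ : IsSmoothProjective m Y) (B : HodgeModel m Y)
          (a : ℕ) (r : ℕ) (_ : a + 2 * r = 2 * p) (_ : 1 ≤ r)
          (φ : complexBetti Y a →ₗ[ℂ] complexBetti X (2 * p))
          (_ : ∀ c, IsRationalClass c → IsRationalClass (φ c))
          (_ : ∀ (p' q' : ℕ), p' + q' = a → ∀ c, B.pullback a c ∈ B.hodgePQ a p' q' →
            A.pullback (2 * p) (φ c) ∈ A.hodgePQ (2 * p) (p' + r) (q' + r)),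
          LinearMap.range φ :=
  fun _ _ hp hX A r b hb hsub hbot hirr hge ↦
    le_hodgeMaps_of_le_hodgeCorrespondences hX A (hEff hp hX A r b hb hsub hbot hirr hge)

end Summit.HodgeConjecture.HodgeConjecture.Theorems

end
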